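import Summits.MatrixMultiplication.OmegaCensus.DominoZpZpKit
import HarnessLib

/-!
# Moments of line shadows on `ZMod p × ZMod p` (consistency across directions)

ω-census `pub-omega`, family (b3), seat pub-omega-group gen 26.  Framing: lottery ticket; floor = certified bounds/negative
ranges.  VALUE: the bookkeeping identities behind the SHADOW-CONSISTENCY route for the `ℤ_p²` domino column
(`HOME/pub-omega-group-g26/FAMILY-B-ADDENDUM-g26.md`): the `j`-th moment of the shadow (fibre counts) of a finite family of
points `u a ∈ ZMod p × ZMod p` along the line form `lmap c₁ c₂` is the value at `(c₁, c₂)` of ONE binary form of degree `j` whose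
coefficients are the mixed moments `μ_{i,k} = Σ_a (u a).1^i (u a).2^k`; so the shadows of one set in the `p + 1` directions
(`lineDir p j = lmap (dirFst j) (dirSnd j)`) are not independent.  NOT progress on ω.

* `sum_pow_mul_card_fibre`: `Σ_v v^j · #{a ∈ X : g a = v} = Σ_{a∈X} (g a)^j` (any `g : A → ZMod p`);
* `lmap_pow_eq_sum_moments`: `Σ_{a∈X} (c₁ (u a).1 + c₂ (u a).2)^j = Σ_{i ≤ j} C(j,i) c₁^i c₂^{j−i} μ_{i,j−i}`;
* `shadow_moment_eq`: the two combined for the shadow `v ↦ #{a ∈ X : lmap c₁ c₂ (u a) = v}`;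
* `shadow_moment_fst` / `shadow_moment_snd`: the coordinate directions read off `μ_{j,0}` and `μ_{0,j}`.
-/

namespace Summit.MatrixMultiplication.OmegaCensus

open Finset

namespace ZpZpDomino

variable {p : ℕ} {A : Type*}

/-- Mixed power moment `μ_{i,k}(u, X) = Σ_{a∈X} (u a).1^i · (u a).2^k`. [folklore] -/
def mixedMoment (u : A → ZMod p × ZMod p) (X : Finset A) (i k : ℕ) : ZMod p :=
  ∑ a ∈ X, (u a).1 ^ i * (u a).2 ^ k

/-- Fibre-sum form of a power moment: `Σ_v v^j · #{a ∈ X : g a = v} = Σ_{a∈X} (g a)^j`. [folklore] -/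
theorem sum_pow_mul_card_fibre [Fintype (ZMod p)] (g : A → ZMod p) (X : Finset A) (j : ℕ) :
    ∑ v : ZMod p, v ^ j * ((X.filter fun a => g a = v).card : ZMod p) = ∑ a ∈ X, (g a) ^ j := by
  rw [← Finset.sum_fiberwise_of_maps_to (s := X) (t := (univ : Finset (ZMod p))) (g := g) (fun a _ => mem_univ _)
    (fun a => (g a) ^ j)]
  refine sum_congr rfl fun v _ => ?_
  rw [Finset.card_eq_sum_ones, Nat.cast_sum, Nat.cast_one, mul_sum, mul_one]
  refine sum_congr rfl fun a ha => ?_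
  rw [(mem_filter.1 ha).2]

/-- **Binomial expansion of the shadow moment along `lmap c₁ c₂`**:
`Σ_{a∈X} (c₁ (u a).1 + c₂ (u a).2)^j = Σ_{i ≤ j} C(j,i) · c₁^i · c₂^{j−i} · μ_{i,j−i}`. [folklore] -/
theorem lmap_pow_eq_sum_moments (u : A → ZMod p × ZMod p) (X : Finset A) (c₁ c₂ : ZMod p) (j : ℕ) :
    ∑ a ∈ X, (c₁ * (u a).1 + c₂ * (u a).2) ^ j =
      ∑ i ∈ range (j + 1), (j.choose i : ZMod p) * c₁ ^ i * c₂ ^ (j - i) * mixedMoment u X i (j - i) := by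
  unfold mixedMoment
  simp_rw [mul_sum]
  rw [sum_comm]
  refine sum_congr rfl fun a _ => ?_
  rw [add_pow]
  refine sum_congr rfl fun i _ => ?_
  rw [mul_pow, mul_pow]
  ring

/-- **Shadow moments are values of one binary form**: for the shadow `F(v) = #{a ∈ X : lmap c₁ c₂ (u a) = v}`,
`Σ_v v^j F(v) = Σ_{i ≤ j} C(j,i) c₁^i c₂^{j−i} μ_{i,j−i}`. [folklore] -/
theorem shadow_moment_eq [Fintype (ZMod p)] (u : A → ZMod p × ZMod p) (X : Finset A) (c₁ c₂ : ZMod p) (j : ℕ) :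
    ∑ v : ZMod p, v ^ j * ((X.filter fun a => lmap c₁ c₂ (u a) = v).card : ZMod p) =
      ∑ i ∈ range (j + 1), (j.choose i : ZMod p) * c₁ ^ i * c₂ ^ (j - i) * mixedMoment u X i (j - i) := by
  rw [sum_pow_mul_card_fibre (fun a => lmap c₁ c₂ (u a)) X j]
  simp only [lmap_apply]
  exact lmap_pow_eq_sum_moments u X c₁ c₂ j

/-- The first-coordinate shadow (`lmap 1 0`, direction `0`): `Σ_v v^j F(v) = μ_{j,0}`. [folklore] -/
theorem shadow_moment_fst [Fintype (ZMod p)] (u : A → ZMod p × ZMod p) (X : Finset A) (j : ℕ) :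
    ∑ v : ZMod p, v ^ j * ((X.filter fun a => (u a).1 = v).card : ZMod p) = mixedMoment u X j 0 := by
  rw [sum_pow_mul_card_fibre (fun a => (u a).1) X j]
  unfold mixedMoment
  exact sum_congr rfl fun a _ => by rw [pow_zero, mul_one]

/-- The second-coordinate shadow (`lmap 0 1`, direction `1`): `Σ_v v^j F(v) = μ_{0,j}`. [folklore] -/
theorem shadow_moment_snd [Fintype (ZMod p)] (u : A → ZMod p × ZMod p) (X : Finset A) (j : ℕ) :
    ∑ v : ZMod p, v ^ j * ((X.filter fun a => (u a).2 = v).card : ZMod p) = mixedMoment u X 0 j := by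
  rw [sum_pow_mul_card_fibre (fun a => (u a).2) X j]
  unfold mixedMoment
  exact sum_congr rfl fun a _ => by rw [pow_zero, one_mul]

/-- The missing point moves linearly too: `lmap c₁ c₂ x₀ = c₁ x₀.1 + c₂ x₀.2` (for the shift `s` of the line identity). [folklore] -/
theorem lmap_point (c₁ c₂ : ZMod p) (x₀ : ZMod p × ZMod p) : lmap c₁ c₂ x₀ = c₁ * x₀.1 + c₂ * x₀.2 :=
  lmap_apply c₁ c₂ x₀

end ZpZpDomino

end Summit.MatrixMultiplication.OmegaCensus
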